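import Summits.CriticalPhenomena.PercolationContinuityZ3.Theorems.Transplant.SkelPhiApronKitAvoid
import Summits.CriticalPhenomena.PercolationContinuityZ3.Theorems.Transplant.KNLevelsStepIV
import HarnessLib

/-!
# N1 (the `{±1}` node), LEVEL 1, kit adapter file N-K5a: AROUND THE KIT CENTRE — the graph ball about the kit centre of a near contact lies in the
# window, its shell part is exactly `{sdepth ≥ D}`; THE CAPTURE OF AN EXIT EDGE (the outside end of a `G`-edge leaving the shell near the centre
# lies in the apron, by (κ) + frames); and THE EVENT INCLUSION `{Λ ↔ P_exit in Rg c} ∩ lattOnly ⊆ {Λ ↔ face in Qk}` feeding `h2` of `stepIV_out`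

builds on p205010 (kernel theorem, internal audit signed; external expert review pending) — nothing in this file uses p205010; nothing here is a
claim about the open node `SamePDropOfSkeletonNeg`.
Lane `prim-bschramm`, seat `prim-bschramm-p1` (gen 11; design KIT-APRON-N1); helper file (`--supports stmt-CriticalPhenomena-4575 --as helper`).
* §1 `linForm_eq_coef`, `sdepth_sub_le_of_mem_graphBall`, **`ball_ctCtr_mem_winLevel`**, **`mem_shellWinA_iff_of_ball_ctCtr`**;
* §2 **`mem_ctApron_of_exit`** (capture), `mem_ctFace_of_exit`;
* §3 **`linkIn_exit_subset`**; §4 `zone_subset_ctQk`, `disjoint_ctFace_zone`.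
[cite: KozmaNitzan2024, §4 Lemma 10, pp. 19–21 (Step IV: the relay face; (22)–(23))] [cite: GrimmettPercolation1999, §7.2]
-/

noncomputable section

open scoped Classical

namespace Summit.CriticalPhenomena.PercolationContinuityZ3.Theorems.Transplant

namespace Skelφ

open Literature.Probability.Percolation Literature.Probability.LatticeModels SimpleGraph KNLevels
open Literature.Probability.Percolation.KozmaNitzan.Cells (oth oth_ne eq_oth_of_ne oth_oth)
open Literature.Barriers.CriticalPhenomena (graphBall graphBall_finite mem_graphBall_self graphBall_mono)
open Skel (winGraph winGraph_adj KitGeom)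
open SkelI (tanOff tanTgt tanTgt_mem)

variable {V : Type} [DecidableEq V] {G : SimpleGraph V} [G.LocallyFinite] {ψ φ : V → Site 2}

/-! ## §1 The graph ball about the kit centre -/

omit [DecidableEq V] [G.LocallyFinite] in
/-- A linear form read along the axis `a` and its complement. [folklore] -/
theorem linForm_eq_coef (cα cβ : ℤ) (a : Fin 2) (x : Site 2) :
    linForm cα cβ x = coef cα cβ a * x a + coef cα cβ (oth a) * x (oth a) := by
  fin_cases a
  · simp [linForm, coef, oth]
  · simp [linForm, coef, oth]; ring

omit [DecidableEq V] [G.LocallyFinite] in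
/-- The depth moves by at most the graph distance (`ψ` Lipschitz). [folklore] -/
theorem sdepth_sub_le_of_mem_graphBall (hlip : Lip G ψ) {Lo Hi : Site 2} (i₀ : Fin 2) (σ₀ : ℤˣ) {u v : V} {r : ℕ}
    (hv : v ∈ graphBall G u r) : |sdepth ψ Lo Hi i₀ σ₀ v - sdepth ψ Lo Hi i₀ σ₀ u| ≤ r := by
  have h := abs_sub_le_of_mem_graphBall hlip hv i₀
  unfold sdepth; split_ifs
  · rw [show Hi i₀ - ψ v i₀ - (Hi i₀ - ψ u i₀) = -(ψ v i₀ - ψ u i₀) by ring, abs_neg]; exact h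
  · rw [show ψ v i₀ - Lo i₀ - (ψ u i₀ - Lo i₀) = ψ v i₀ - ψ u i₀ by ring]; exact h

section Ball

variable {w₀ : V} {R : ℕ} {Lo Hi : Site 2} (SF : ∀ (i : Fin 2) (σ : ℤˣ), SideForm ψ φ Lo Hi i σ) {P : ApronPrm} {KCmax ρ : ℕ}

/-- The kit centre of a contact sits at depth `≥ D` (`θ (2+d) ≤ θ D + A`, `A ≥ 0`). [folklore] -/
theorem shellD_le_sdepth_ctCtr' (hlip : Lip G ψ) (hq : QStepsN G ψ P.N) (hstep : Steps G φ) (hw2 : ∀ i, Lo i + 2 ≤ Hi i) (hA : 0 ≤ P.A)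
    (hθA : ∀ (i : Fin 2) (σ : ℤˣ), (SF i σ).θ (2 + P.d) ≤ (SF i σ).θ (shellD P) + P.A)
    {x : V} (hx : x ∈ outerBoundary (winGraph G w₀ R) (Win G ψ w₀ (Finset.Icc Lo Hi) R)) :
    (shellD P : ℤ) ≤ sdepth ψ Lo Hi (ctDir G ψ w₀ R Lo Hi x).1 (ctDir G ψ w₀ R Lo Hi x).2 (ctCtr G SF P w₀ R x) := by
  have ht := ψ_ctT1 hlip hq hw2 hx
  have hzlt := (SF (ctDir G ψ w₀ R Lo Hi x).1 (ctDir G ψ w₀ R Lo Hi x).2).lin_lt_of_sdepth_lt (φ := φ) (v := ctT1 G ψ P w₀ R Lo Hi x)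
    (m := 2 + P.d) (by rw [ht.1]; omega)
  exact shellD_le_sdepth_ctCtr SF hstep hA (by have := hθA (ctDir G ψ w₀ R Lo Hi x).1 (ctDir G ψ w₀ R Lo Hi x).2; linarith)

/-- **The ball of radius `ρ` about the kit centre of a near contact**: (a) inside `B_G(w₀, R)`, (b) tangentially at least `D` inside, (c) at depth
between `D − ρ` and `(Hi − Lo) − D` behind the exit side. [this work] -/
theorem ball_ctCtr_facts (hlip : Lip G ψ) (hq : QStepsN G ψ P.N) (hstep : Steps G φ) (hwide : ∀ i, Lo i + 2 * tanOff P.ℓs P.M ≤ Hi i)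
    (hKC : ∀ (i : Fin 2) (σ : ℤˣ) (z : Site 2), (SF i σ).θ (1 + P.d) ≤ (SF i σ).lin z → (SF i σ).lin z < (SF i σ).θ (2 + P.d) →
      (SF i σ).kitK z (shellD P) P.A ≤ KCmax)
    (hA : 0 ≤ P.A) (hθA : ∀ (i : Fin 2) (σ : ℤˣ), (SF i σ).θ (2 + P.d) ≤ (SF i σ).θ (shellD P) + P.A)
    (hr₀ : P.N * (tanOff P.ℓs P.M + 1) + P.N * P.d + (KCmax + ρ) ≤ P.r₀) (hR : P.r₀ ≤ R)
    (hT : (shellD P : ℤ) + KCmax + ρ ≤ tanOff P.ℓs P.M) (hDw : ∀ i, Lo i + ((shellD P + 1 + P.d + KCmax + ρ : ℕ) : ℤ) ≤ Hi i)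
    {x : V} (hx : x ∈ outerBoundary (winGraph G w₀ R) (Win G ψ w₀ (Finset.Icc Lo Hi) R)) (hnear : IsNear G ψ Lo Hi P w₀ R x)
    {v : V} (hv : v ∈ graphBall G (ctCtr G SF P w₀ R x) ρ) :
    v ∈ graphBall G w₀ R ∧
      (Lo (oth (ctDir G ψ w₀ R Lo Hi x).1) + shellD P ≤ ψ v (oth (ctDir G ψ w₀ R Lo Hi x).1) ∧
        ψ v (oth (ctDir G ψ w₀ R Lo Hi x).1) ≤ Hi (oth (ctDir G ψ w₀ R Lo Hi x).1) - shellD P) ∧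
      (shellD P : ℤ) - ρ ≤ sdepth ψ Lo Hi (ctDir G ψ w₀ R Lo Hi x).1 (ctDir G ψ w₀ R Lo Hi x).2 v ∧
      sdepth ψ Lo Hi (ctDir G ψ w₀ R Lo Hi x).1 (ctDir G ψ w₀ R Lo Hi x).2 v ≤
        Hi (ctDir G ψ w₀ R Lo Hi x).1 - Lo (ctDir G ψ w₀ R Lo Hi x).1 - shellD P := by
  have hw2 : ∀ i, Lo i + 2 ≤ Hi i := fun i => by have := hwide i; unfold tanOff at this; omega
  have ht := ψ_ctT1 hlip hq hw2 hx
  have hzge := (SF (ctDir G ψ w₀ R Lo Hi x).1 (ctDir G ψ w₀ R Lo Hi x).2).le_lin_of_le_sdepth (φ := φ) (v := ctT1 G ψ P w₀ R Lo Hi x)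
    (m := 1 + P.d) (by rw [ht.1])
  have hzlt := (SF (ctDir G ψ w₀ R Lo Hi x).1 (ctDir G ψ w₀ R Lo Hi x).2).lin_lt_of_sdepth_lt (φ := φ) (v := ctT1 G ψ P w₀ R Lo Hi x)
    (m := 2 + P.d) (by rw [ht.1]; omega)
  -- distances
  have hct : ctCtr G SF P w₀ R x ∈ graphBall G (ctT1 G ψ P w₀ R Lo Hi x) KCmax :=
    graphBall_mono G _ (hKC _ _ _ hzge hzlt) (ctCtr_mem_graphBall SF (P := P) (w₀ := w₀) (R := R) hstep x)
  have hvt : v ∈ graphBall G (ctT1 G ψ P w₀ R Lo Hi x) (KCmax + ρ) := BoxProdZ2.mem_graphBall_add G hct hv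
  have hvy : v ∈ graphBall G (ctY G ψ w₀ R Lo Hi x) (P.N * (tanOff P.ℓs P.M + 1) + P.N * P.d + (KCmax + ρ)) :=
    BoxProdZ2.mem_graphBall_add G (ctT1_mem_graphBall hq hwide hx) hvt
  refine ⟨?_, ?_, ?_, ?_⟩
  · have h := BoxProdZ2.mem_graphBall_add G hnear (graphBall_mono G _ hr₀ hvy)
    rwa [Nat.sub_add_cancel hR] at h
  · have h := abs_sub_le_of_mem_graphBall hlip hvt (oth (ctDir G ψ w₀ R Lo Hi x).1)
    rw [ht.2, abs_le] at h
    have hτ := tanTgt_mem (oth (ctDir G ψ w₀ R Lo Hi x).1) (hwide (oth _)) (ψ (ctY G ψ w₀ R Lo Hi x))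
    push_cast at h
    constructor <;> linarith [h.1, h.2, hτ.1, hτ.2]
  · have hc := shellD_le_sdepth_ctCtr' SF hlip hq hstep hw2 hA hθA hx
    have h := sdepth_sub_le_of_mem_graphBall hlip (Lo := Lo) (Hi := Hi) (ctDir G ψ w₀ R Lo Hi x).1 (ctDir G ψ w₀ R Lo Hi x).2 hv
    rw [abs_le] at h; linarith [h.1]
  · have h := sdepth_sub_le_of_mem_graphBall hlip (Lo := Lo) (Hi := Hi) (ctDir G ψ w₀ R Lo Hi x).1 (ctDir G ψ w₀ R Lo Hi x).2 hvt
    rw [ht.1, abs_le] at h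
    have hwid := hDw (ctDir G ψ w₀ R Lo Hi x).1
    push_cast at h hwid ⊢
    linarith [h.2]

/-- **In that ball, the shell window is exactly `{sdepth ≥ D}`.** [this work] -/
theorem mem_shellWinA_iff_of_ball_ctCtr (hlip : Lip G ψ) (hq : QStepsN G ψ P.N) (hstep : Steps G φ)
    (hwide : ∀ i, Lo i + 2 * tanOff P.ℓs P.M ≤ Hi i)
    (hKC : ∀ (i : Fin 2) (σ : ℤˣ) (z : Site 2), (SF i σ).θ (1 + P.d) ≤ (SF i σ).lin z → (SF i σ).lin z < (SF i σ).θ (2 + P.d) →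
      (SF i σ).kitK z (shellD P) P.A ≤ KCmax)
    (hA : 0 ≤ P.A) (hθA : ∀ (i : Fin 2) (σ : ℤˣ), (SF i σ).θ (2 + P.d) ≤ (SF i σ).θ (shellD P) + P.A)
    (hr₀ : P.N * (tanOff P.ℓs P.M + 1) + P.N * P.d + (KCmax + ρ) ≤ P.r₀) (hR : P.r₀ ≤ R)
    (hT : (shellD P : ℤ) + KCmax + ρ ≤ tanOff P.ℓs P.M) (hDw : ∀ i, Lo i + ((shellD P + 1 + P.d + KCmax + ρ : ℕ) : ℤ) ≤ Hi i)
    {x : V} (hx : x ∈ outerBoundary (winGraph G w₀ R) (Win G ψ w₀ (Finset.Icc Lo Hi) R)) (hnear : IsNear G ψ Lo Hi P w₀ R x)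
    {v : V} (hv : v ∈ graphBall G (ctCtr G SF P w₀ R x) ρ) :
    v ∈ shellWinA G ψ w₀ R Lo Hi P.ℓs ↔ (shellD P : ℤ) ≤ sdepth ψ Lo Hi (ctDir G ψ w₀ R Lo Hi x).1 (ctDir G ψ w₀ R Lo Hi x).2 v := by
  obtain ⟨hball, htan, -, htop⟩ := ball_ctCtr_facts SF hlip hq hstep hwide hKC hA hθA hr₀ hR hT hDw hx hnear hv
  constructor
  · intro h
    by_contra hlt; push Not at hlt
    exact not_mem_shellWinA_of_sdepth_lt (G := G) (w₀ := w₀) (R := R) (by unfold shellD at hlt; exact_mod_cast hlt) h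
  · intro hD
    unfold shellWinA
    rw [mem_Win, Finset.mem_Icc]
    have hDdef : (((2 * P.ℓs + 2 : ℕ) : Site 2) : Site 2) = fun _ => (shellD P : ℤ) := by funext i; simp [shellD]
    rw [hDdef]
    unfold sdepth at hD htop
    refine ⟨hball, ?_, ?_⟩ <;> intro i <;> simp only [Pi.add_apply, Pi.sub_apply]
    · by_cases hi : i = (ctDir G ψ w₀ R Lo Hi x).1
      · rw [hi]; split_ifs at hD htop <;> omega
      · rw [eq_oth_of_ne hi]; exact htan.1
    · by_cases hi : i = (ctDir G ψ w₀ R Lo Hi x).1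
      · rw [hi]; split_ifs at hD htop <;> omega
      · rw [eq_oth_of_ne hi]; exact htan.2

end Ball

/-! ## §2 Capture of an exit edge -/

section Capture

variable {w₀ : V} {R : ℕ} {Lo Hi : Site 2} (SF : ∀ (i : Fin 2) (σ : ℤˣ), SideForm ψ φ Lo Hi i σ) {P : ApronPrm} {Kmax KCmax Rs : ℕ}
  {types : Finset V}

/-- **CAPTURE**: for a near contact `x` with kit centre `c`, a `G`-edge `u — w` with `u` in the shell and `w ∈ B_G(c, Rs)` off the shell has
`w` in the apron of `x` ((κ) + frames; placement inequalities). [cite: KozmaNitzan2024, §4 p. 20 ((22)–(23))] -/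
theorem mem_ctApron_of_exit (hlipψ : Lip G ψ) (hq : QStepsN G ψ P.N) (hlipφ : Lip G φ) (hstep : Steps G φ) (hfr : Frames G φ types)
    (hκ : CylConn G φ types) (hℓ : 1 ≤ P.ℓ) (hwide : ∀ i, Lo i + 2 * tanOff P.ℓs P.M ≤ Hi i)
    (hK : ∀ (i : Fin 2) (σ : ℤˣ) (z : Site 2), (SF i σ).θ (1 + P.d) ≤ (SF i σ).lin z → ∀ m : ℤ, -(P.W : ℤ) ≤ m → m ≤ P.W →
      (SF i σ).apronK z (shellD P) P.ℓ m ≤ Kmax)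
    (hKC : ∀ (i : Fin 2) (σ : ℤˣ) (z : Site 2), (SF i σ).θ (1 + P.d) ≤ (SF i σ).lin z → (SF i σ).lin z < (SF i σ).θ (2 + P.d) →
      (SF i σ).kitK z (shellD P) P.A ≤ KCmax)
    (hA : 0 ≤ P.A) (hθA : ∀ (i : Fin 2) (σ : ℤˣ), (SF i σ).θ (2 + P.d) ≤ (SF i σ).θ (shellD P) + P.A)
    (hcap : ∀ (i : Fin 2) (σ : ℤˣ) (z : Site 2), (SF i σ).lin z < (SF i σ).θ (2 + P.d) →
      (P.ℓ : ℤ) * ((SF i σ).s * coef (SF i σ).cα (SF i σ).cβ (SF i σ).a) + (Rs : ℤ) * |coef (SF i σ).cα (SF i σ).cβ (oth (SF i σ).a)| +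
        (SF i σ).UL ≤ (SF i σ).θ (shellD P) - (SF i σ).lin z)
    (hW : Rs + P.ℓ ≤ P.W) (hR' : cylRadMax G φ types P.ℓ (Rs + KCmax + (P.W + Kmax)) ≤ P.R')
    (hr₀ : P.N * (tanOff P.ℓs P.M + 1) + P.N * P.d + (KCmax + Rs) ≤ P.r₀) (hR : P.r₀ ≤ R)
    (hT : (shellD P : ℤ) + KCmax + Rs ≤ tanOff P.ℓs P.M) (hDw : ∀ i, Lo i + ((shellD P + 1 + P.d + KCmax + Rs : ℕ) : ℤ) ≤ Hi i)
    {x : V} (hx : x ∈ outerBoundary (winGraph G w₀ R) (Win G ψ w₀ (Finset.Icc Lo Hi) R)) (hnear : IsNear G ψ Lo Hi P w₀ R x)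
    {u w : V} (hu : u ∈ shellWinA G ψ w₀ R Lo Hi P.ℓs) (hw : w ∈ graphBall G (ctCtr G SF P w₀ R x) Rs)
    (hwS : w ∉ shellWinA G ψ w₀ R Lo Hi P.ℓs) (hadj : G.Adj u w) : w ∈ ctApron G SF P w₀ R x := by
  have hw2 : ∀ i, Lo i + 2 ≤ Hi i := fun i => by have := hwide i; unfold tanOff at this; omega
  set F := SF (ctDir G ψ w₀ R Lo Hi x).1 (ctDir G ψ w₀ R Lo Hi x).2 with hF
  set t₁ := ctT1 G ψ P w₀ R Lo Hi x with ht₁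
  have ht := ψ_ctT1 hlipψ hq hw2 hx
  have hzge : F.θ (1 + P.d) ≤ F.lin (φ t₁) := F.le_lin_of_le_sdepth (by rw [ht₁, ht.1])
  have hzlt : F.lin (φ t₁) < F.θ (2 + P.d) := F.lin_lt_of_sdepth_lt (by rw [ht₁, ht.1]; omega)
  have hC := F.clim_pos
  -- depth of `w`: just below the line
  have hwD : sdepth ψ Lo Hi (ctDir G ψ w₀ R Lo Hi x).1 (ctDir G ψ w₀ R Lo Hi x).2 w < shellD P := by
    by_contra hge; push Not at hge
    exact hwS ((mem_shellWinA_iff_of_ball_ctCtr SF hlipψ hq hstep hwide hKC hA hθA hr₀ hR hT hDw hx hnear hw).2 hge)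
  have hLw_lt : F.lin (φ w) < F.θ (shellD P) := F.lin_lt_of_sdepth_lt hwD
  have huD : (shellD P : ℤ) ≤ sdepth ψ Lo Hi (ctDir G ψ w₀ R Lo Hi x).1 (ctDir G ψ w₀ R Lo Hi x).2 u := by
    by_contra hlt; push Not at hlt
    exact not_mem_shellWinA_of_sdepth_lt (G := G) (w₀ := w₀) (R := R) (by unfold shellD at hlt; exact_mod_cast hlt) hu
  have hLu : F.θ (shellD P) ≤ F.lin (φ u) := F.le_lin_of_le_sdepth huD
  have hLuw : |F.lin (φ u) - F.lin (φ w)| ≤ F.UL := by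
    have h := abs_linForm_sub_le F.cα F.cβ (x := φ u) (y := φ w) (hlipφ hadj 0) (hlipφ hadj 1)
    unfold SideForm.lin; rw [SideForm.UL_eq]; exact h
  rw [abs_le] at hLuw
  have hLw_ge : F.θ (shellD P) - F.UL ≤ F.lin (φ w) := by linarith [hLuw.2]
  -- planar offsets of `w` from `t₁`
  have hct : ctCtr G SF P w₀ R x ∈ graphBall G t₁ KCmax :=
    graphBall_mono G _ (hKC _ _ _ hzge hzlt) (ctCtr_mem_graphBall SF (P := P) (w₀ := w₀) (R := R) hstep x)
  have hwt : w ∈ graphBall G t₁ (KCmax + Rs) := BoxProdZ2.mem_graphBall_add G hct hw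
  -- planar offsets: `φ c = kitPt (φ t₁)` differs from `φ t₁` along `a` only, and `w` is `φ`-within `Rs` of `c`
  have hφc : φ (ctCtr G SF P w₀ R x) = F.kitPt (φ t₁) (shellD P) P.A := by rw [ht₁, hF]; exact φ_ctCtr SF hstep x
  have hΔc : ∀ i, |φ w i - φ (ctCtr G SF P w₀ R x) i| ≤ (Rs : ℤ) := fun i => abs_sub_le_of_mem_graphBall hlipφ hw i
  have hΔb : |φ w (oth F.a) - φ t₁ (oth F.a)| ≤ (Rs : ℤ) := by
    have e : φ t₁ (oth F.a) = φ (ctCtr G SF P w₀ R x) (oth F.a) := by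
      rw [hφc]; unfold SideForm.kitPt; rw [Pi.add_apply, Pi.single_eq_of_ne (oth_ne F.a), add_zero]
    rw [e]; exact hΔc (oth F.a)
  -- the capture indices
  set mk := F.captureIdx (φ t₁) (φ w) P.ℓ with hmk
  have hm : -(P.W : ℤ) ≤ mk.1 ∧ mk.1 ≤ P.W := by
    have e : mk.1 = (φ w - φ t₁) (oth F.a) - P.ℓ * F.sb := rfl
    have h1 := hΔb; rw [abs_le] at h1
    have hsb := F.sb_cases
    have hW' : (Rs : ℤ) + P.ℓ ≤ P.W := by exact_mod_cast hW
    simp only [Pi.sub_apply] at e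
    rcases hsb with hs | hs <;> rw [e, hs] <;> constructor <;> linarith
  -- `k ≥ 0`: `(s Δa)·C ≥ ℓ·C`
  have hk0 : 0 ≤ mk.2 := by
    have e : mk.2 = (F.s : ℤ) * (φ w - φ t₁) F.a - P.ℓ := rfl
    rw [e]
    -- `L(w) − L(t₁) = coef a Δa + coef b Δb`
    have eL : F.lin (φ w) - F.lin (φ t₁) =
        coef F.cα F.cβ F.a * (φ w F.a - φ t₁ F.a) + coef F.cα F.cβ (oth F.a) * (φ w (oth F.a) - φ t₁ (oth F.a)) := by
      unfold SideForm.lin; rw [linForm_eq_coef F.cα F.cβ F.a, linForm_eq_coef F.cα F.cβ F.a]; ring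
    have hb : |coef F.cα F.cβ (oth F.a) * (φ w (oth F.a) - φ t₁ (oth F.a))| ≤ (Rs : ℤ) * |coef F.cα F.cβ (oth F.a)| := by
      rw [abs_mul, mul_comm]; exact mul_le_mul_of_nonneg_right hΔb (abs_nonneg _)
    rw [abs_le] at hb
    have hcapx := hcap (ctDir G ψ w₀ R Lo Hi x).1 (ctDir G ψ w₀ R Lo Hi x).2 (φ t₁) hzlt
    rw [← hF] at hcapx
    have hss : (F.s : ℤ) * (F.s : ℤ) = 1 := by rcases Int.units_eq_one_or F.s with h | h <;> simp [h]
    -- `(s Δa) C = coef a Δa` with `C = s coef a`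
    have ekey : ((F.s : ℤ) * (φ w - φ t₁) F.a) * ((F.s : ℤ) * coef F.cα F.cβ F.a) = coef F.cα F.cβ F.a * (φ w F.a - φ t₁ F.a) := by
      simp only [Pi.sub_apply]; linear_combination (coef F.cα F.cβ F.a * (φ w F.a - φ t₁ F.a)) * hss
    have hineq : (P.ℓ : ℤ) * ((F.s : ℤ) * coef F.cα F.cβ F.a) ≤ ((F.s : ℤ) * (φ w - φ t₁) F.a) * ((F.s : ℤ) * coef F.cα F.cβ F.a) := by
      rw [ekey]; linarith [hb.2]
    have := le_of_mul_le_mul_right hineq hC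
    linarith
  -- `k` as a natural, `k ≤ apronK m ≤ Kmax`
  obtain ⟨k, hk⟩ : ∃ k : ℕ, (k : ℤ) = mk.2 := ⟨mk.2.toNat, Int.toNat_of_nonneg hk0⟩
  have hspec := F.captureIdx_spec (φ t₁) (φ w) P.ℓ (k := k) hk
  rw [← hmk] at hspec
  have hbase : F.lin (apronPt (φ t₁) F.a F.s mk.1 0) + P.ℓ * F.UL < F.θ (shellD P) := by
    have e : F.lin (apronPt (φ t₁) F.a F.s mk.1 k) = F.lin (apronPt (φ t₁) F.a F.s mk.1 0) + (k : ℤ) * ((F.s : ℤ) * coef F.cα F.cβ F.a) := by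
      rw [F.lin_apronPt, F.lin_apronPt]; push_cast; ring
    have : (0 : ℤ) ≤ (k : ℤ) * ((F.s : ℤ) * coef F.cα F.cβ F.a) := by positivity
    linarith [hspec.2]
  have hkK : k ≤ F.apronK (φ t₁) (shellD P) P.ℓ mk.1 := by
    have e : F.lin (apronPt (φ t₁) F.a F.s mk.1 k) = F.lin (apronPt (φ t₁) F.a F.s mk.1 0) + (k : ℤ) * ((F.s : ℤ) * coef F.cα F.cβ F.a) := by
      rw [F.lin_apronPt, F.lin_apronPt]; push_cast; ring
    have hkC : (k : ℤ) * ((F.s : ℤ) * coef F.cα F.cβ F.a) ≤ F.θ (shellD P) - 1 - F.lin (apronPt (φ t₁) F.a F.s mk.1 0) - P.ℓ * F.UL := by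
      linarith [hspec.2]
    have h1 : (k : ℤ) ≤ (F.θ (shellD P) - 1 - F.lin (apronPt (φ t₁) F.a F.s mk.1 0) - P.ℓ * F.UL) / ((F.s : ℤ) * coef F.cα F.cβ F.a) :=
      Int.le_ediv_of_mul_le hC hkC
    have h2 : ((F.apronK (φ t₁) (shellD P) P.ℓ mk.1 : ℕ) : ℤ) =
        (F.θ (shellD P) - 1 - F.lin (apronPt (φ t₁) F.a F.s mk.1 0) - P.ℓ * F.UL) / ((F.s : ℤ) * coef F.cα F.cβ F.a) := by
      unfold SideForm.apronK; exact Int.toNat_of_nonneg (le_trans (by positivity) h1)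
    exact_mod_cast h1.trans_eq h2.symm
  have hkmax : k ≤ Kmax := hkK.trans (hK _ _ _ hzge mk.1 hm.1 hm.2)
  -- graph distance from `w` to the column vertex `(m, k)`
  have hcol := apronCol_mem_graphBall hstep t₁ F.a F.s mk.1 k
  have hwcol : w ∈ graphBall G (apronCol G φ t₁ F.a F.s mk.1 k) (Rs + KCmax + (P.W + Kmax)) := by
    have h1 := BoxProdZ2.mem_graphBall_add G ((BoxProdZ2.mem_graphBall_comm G).1 hcol) hwt
    exact graphBall_mono G _ (by omega) h1
  have hφw : φ w - φ (apronCol G φ t₁ F.a F.s mk.1 k) ∈ box 2 P.ℓ := by rw [φ_apronCol hstep]; exact hspec.1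
  unfold ctApron
  exact mem_apronFin_of_near hfr hκ hℓ hR' (by omega) hkK hwcol hφw

/-- Hence the shell end of such an edge, if it lies in the short region, is a FACE vertex. [folklore] -/
theorem mem_ctFace_of_exit (Rg : V → Finset V) {x u w : V} (hu : u ∈ shellWinA G ψ w₀ R Lo Hi P.ℓs) (huR : u ∈ Rg (ctCtr G SF P w₀ R x))
    (hw : w ∈ ctApron G SF P w₀ R x) (hadj : G.Adj u w) : u ∈ ctFace G SF Rg P w₀ R x :=
  mem_ctFace SF Rg (by unfold ctQk; exact Finset.mem_inter.2 ⟨huR, hu⟩) hw hadj.symm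

end Capture

/-! ## §3 The event inclusion behind `h2` -/

section Exit

variable {w₀ : V} {R : ℕ} {Lo Hi : Site 2} (SF : ∀ (i : Fin 2) (σ : ℤˣ), SideForm ψ φ Lo Hi i σ) (Rg : V → Finset V) {P : ApronPrm}

/-- **First exit of an open path from the shell**: if every configuration-open pair inside `D'` is a `G'`-edge (`G' ≤ G`), `Rg c ⊆ D'`, the start
set lies in the shell window and the end set misses it, and every `G`-edge `u — w` with `u ∈ Rg c` in the shell and `w ∈ Rg c` off it has `w` in
the apron, then `{Q ↔ Pex in Rg c} ∩ lattOnly G' D' ⊆ {Q ↔ ctFace x in ctQk x}`. [cite: KozmaNitzan2024, §4 p. 20 (Step IV)] -/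
theorem linkIn_exit_subset {G' : SimpleGraph V} [G'.LocallyFinite] (hG' : G' ≤ G) {D' : Finset V} {x : V} {Q Pex : Finset V}
    (hRgD : Rg (ctCtr G SF P w₀ R x) ⊆ D') (hQ : Q ⊆ shellWinA G ψ w₀ R Lo Hi P.ℓs)
    (hPex : ∀ t ∈ Pex, t ∉ shellWinA G ψ w₀ R Lo Hi P.ℓs)
    (hexit : ∀ u w : V, u ∈ Rg (ctCtr G SF P w₀ R x) → u ∈ shellWinA G ψ w₀ R Lo Hi P.ℓs → w ∈ Rg (ctCtr G SF P w₀ R x) →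
      w ∉ shellWinA G ψ w₀ R Lo Hi P.ℓs → G.Adj u w → w ∈ ctApron G SF P w₀ R x) :
    linkIn (↑(Rg (ctCtr G SF P w₀ R x)) : Set V) Q Pex ∩ lattOnly G' D' ⊆
      linkIn (↑(ctQk G SF Rg P w₀ R x) : Set V) Q (ctFace G SF Rg P w₀ R x) := by
  rintro ω ⟨hlink, hlatt⟩
  obtain ⟨s, hs, t, htP, hst⟩ := (mem_linkIn_iff).1 hlink
  rw [DCT16.mem_openConnIn_iff_pathIn] at hst
  obtain ⟨a, b, ha, hb, hbR, hab, hpath⟩ := hst.exit (R := (↑(shellWinA G ψ w₀ R Lo Hi P.ℓs) : Set V)) (Finset.mem_coe.2 (hQ hs))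
    (fun h => hPex t htP (Finset.mem_coe.1 h))
  have haR : a ∈ Rg (ctCtr G SF P w₀ R x) := by have := hpath.right_mem; exact Finset.mem_coe.1 this.2
  rw [Finset.mem_coe] at ha hbR
  -- the open pair `a — b` is a `G'`-edge, hence a `G`-edge
  have hab' : G.Adj a b := by
    rw [openGraph_adj] at hab
    have hpair : s(a, b) ∈ pairsF D' := by
      rw [← Finset.mem_coe, coe_pairsF, mk_mem_wireSet_iff]
      exact ⟨Finset.mem_coe.2 (hRgD haR), Finset.mem_coe.2 (hRgD hbR), hab.2⟩
    exact hG' ((SimpleGraph.mem_edgeSet (G := G')).1 (hlatt _ hpair hab.1))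
  have hbA : b ∈ ctApron G SF P w₀ R x := hexit a b haR ha hbR (fun h => hb (Finset.mem_coe.2 h)) hab'
  have haF : a ∈ ctFace G SF Rg P w₀ R x := mem_ctFace_of_exit SF Rg ha haR hbA hab'
  refine (mem_linkIn_iff).2 ⟨s, hs, a, haF, ?_⟩
  rw [DCT16.mem_openConnIn_iff_pathIn]
  refine hpath.mono ?_
  intro v hv
  rw [Finset.mem_coe]; unfold ctQk
  exact Finset.mem_inter.2 ⟨Finset.mem_coe.1 hv.2, Finset.mem_coe.1 hv.1⟩

end Exit

/-! ## §4 The zone box in the pinned short region; the face off the zone box -/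

section Zone

variable {w₀ : V} {R : ℕ} {Lo Hi : Site 2} (SF : ∀ (i : Fin 2) (σ : ℤˣ), SideForm ψ φ Lo Hi i σ) (Rg : V → Finset V) {P : ApronPrm}
  {KCmax Rs nz : ℕ}

/-- **A planar box of radius `nz` about the kit centre, inside `B_G(c, Rs) ∩ Rg c`, lies in the pinned short region** (`A ≥ nz·UL`; radii). [this work] -/
theorem zone_subset_ctQk (hlip : Lip G ψ) (hq : QStepsN G ψ P.N) (hstep : Steps G φ) (hwide : ∀ i, Lo i + 2 * tanOff P.ℓs P.M ≤ Hi i)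
    (hKC : ∀ (i : Fin 2) (σ : ℤˣ) (z : Site 2), (SF i σ).θ (1 + P.d) ≤ (SF i σ).lin z → (SF i σ).lin z < (SF i σ).θ (2 + P.d) →
      (SF i σ).kitK z (shellD P) P.A ≤ KCmax)
    (hA : 0 ≤ P.A) (hθA : ∀ (i : Fin 2) (σ : ℤˣ), (SF i σ).θ (2 + P.d) ≤ (SF i σ).θ (shellD P) + P.A)
    (hAz : ∀ (i : Fin 2) (σ : ℤˣ), (nz : ℤ) * (SF i σ).UL ≤ P.A)
    (hr₀ : P.N * (tanOff P.ℓs P.M + 1) + P.N * P.d + (KCmax + Rs) ≤ P.r₀) (hR : P.r₀ ≤ R)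
    (hT : (shellD P : ℤ) + KCmax + Rs ≤ tanOff P.ℓs P.M) (hDw : ∀ i, Lo i + ((shellD P + 1 + P.d + KCmax + Rs : ℕ) : ℤ) ≤ Hi i)
    {x : V} (hx : x ∈ outerBoundary (winGraph G w₀ R) (Win G ψ w₀ (Finset.Icc Lo Hi) R)) (hnear : IsNear G ψ Lo Hi P w₀ R x)
    {Z : Finset V} (hZR : Z ⊆ Rg (ctCtr G SF P w₀ R x)) (hZball : ∀ v ∈ Z, v ∈ graphBall G (ctCtr G SF P w₀ R x) Rs)
    (hZbox : ∀ v ∈ Z, φ v - φ (ctCtr G SF P w₀ R x) ∈ box 2 nz) : Z ⊆ ctQk G SF Rg P w₀ R x := by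
  intro v hv
  unfold ctQk
  refine Finset.mem_inter.2 ⟨hZR hv, (mem_shellWinA_iff_of_ball_ctCtr SF hlip hq hstep hwide hKC hA hθA hr₀ hR hT hDw hx hnear (hZball v hv)).2 ?_⟩
  set F := SF (ctDir G ψ w₀ R Lo Hi x).1 (ctDir G ψ w₀ R Lo Hi x).2 with hF
  have hw2 : ∀ i, Lo i + 2 ≤ Hi i := fun i => by have := hwide i; unfold tanOff at this; omega
  have ht := ψ_ctT1 hlip hq hw2 hx
  have hzlt : F.lin (φ (ctT1 G ψ P w₀ R Lo Hi x)) < F.θ (2 + P.d) := F.lin_lt_of_sdepth_lt (by rw [ht.1]; omega)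
  have hc : F.θ (shellD P) + P.A ≤ F.lin (φ (ctCtr G SF P w₀ R x)) :=
    le_lin_ctCtr SF hstep (by have := hθA (ctDir G ψ w₀ R Lo Hi x).1 (ctDir G ψ w₀ R Lo Hi x).2; linarith)
  have hd := F.abs_lin_sub_le_of_mem_box (hZbox v hv)
  rw [abs_le] at hd
  have hAz' := hAz (ctDir G ψ w₀ R Lo Hi x).1 (ctDir G ψ w₀ R Lo Hi x).2
  rw [← hF] at hAz'
  exact F.le_sdepth_of_lin (by linarith [hd.1])

/-- **The face of a near contact misses such a planar box** (`A ≥ (nz + 1)·UL + 1`). [this work] -/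
theorem disjoint_ctFace_zone (hlip : Lip G ψ) (hq : QStepsN G ψ P.N) (hlipφ : Lip G φ) (hstep : Steps G φ) (hw2 : ∀ i, Lo i + 2 ≤ Hi i)
    (hθA : ∀ (i : Fin 2) (σ : ℤˣ), (SF i σ).θ (2 + P.d) ≤ (SF i σ).θ (shellD P) + P.A)
    (hAz : ∀ (i : Fin 2) (σ : ℤˣ), ((nz + 1 : ℕ) : ℤ) * (SF i σ).UL + 1 ≤ P.A)
    (hbelow : ∀ (i : Fin 2) (σ : ℤˣ) (z : Site 2), (SF i σ).lin z < (SF i σ).θ (2 + P.d) → ∀ m : ℤ, -(P.W : ℤ) ≤ m → m ≤ P.W →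
      (SF i σ).lin (apronPt z (SF i σ).a (SF i σ).s m 0) + P.ℓ * (SF i σ).UL < (SF i σ).θ (shellD P))
    (habove : ∀ (i : Fin 2) (σ : ℤˣ) (z : Site 2), (SF i σ).θ (1 + P.d) ≤ (SF i σ).lin z → ∀ m : ℤ, -(P.W : ℤ) ≤ m → m ≤ P.W →
      (SF i σ).θ 1 ≤ (SF i σ).lin (apronPt z (SF i σ).a (SF i σ).s m 0) - P.ℓ * (SF i σ).UL)
    {x : V} (hx : x ∈ outerBoundary (winGraph G w₀ R) (Win G ψ w₀ (Finset.Icc Lo Hi) R))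
    {Z : Finset V} (hZbox : ∀ v ∈ Z, φ v - φ (ctCtr G SF P w₀ R x) ∈ box 2 nz) : Disjoint (ctFace G SF Rg P w₀ R x) Z := by
  rw [Finset.disjoint_left]
  intro u hu huZ
  obtain ⟨w, hw, hadj⟩ := exists_adj_of_mem_ctFace SF Rg hu
  set F := SF (ctDir G ψ w₀ R Lo Hi x).1 (ctDir G ψ w₀ R Lo Hi x).2 with hF
  have ht := ψ_ctT1 hlip hq hw2 hx
  have hzlt : F.lin (φ (ctT1 G ψ P w₀ R Lo Hi x)) < F.θ (2 + P.d) := F.lin_lt_of_sdepth_lt (by rw [ht.1]; omega)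
  have hA0 : 0 ≤ P.A := le_trans (by positivity) (hAz (ctDir G ψ w₀ R Lo Hi x).1 (ctDir G ψ w₀ R Lo Hi x).2)
  have hc : F.θ (shellD P) + P.A ≤ F.lin (φ (ctCtr G SF P w₀ R x)) :=
    le_lin_ctCtr SF hstep (by have := hθA (ctDir G ψ w₀ R Lo Hi x).1 (ctDir G ψ w₀ R Lo Hi x).2; linarith)
  -- `w` is off the shell line, `u` one edge away
  have hwD := (apron_sdepth SF hlip hq hstep hw2 hbelow habove hx hw).2
  have hLw : F.lin (φ w) < F.θ (shellD P) := F.lin_lt_of_sdepth_lt hwD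
  have hLuw : |F.lin (φ u) - F.lin (φ w)| ≤ F.UL := by
    have h := abs_linForm_sub_le F.cα F.cβ (x := φ u) (y := φ w) (hlipφ hadj.symm 0) (hlipφ hadj.symm 1)
    unfold SideForm.lin; rw [SideForm.UL_eq]; exact h
  rw [abs_le] at hLuw
  -- `u` in the box: `L(u) ≥ L(c) − nz·UL`
  have hd := F.abs_lin_sub_le_of_mem_box (hZbox u huZ)
  rw [abs_le] at hd
  have hAz' := hAz (ctDir G ψ w₀ R Lo Hi x).1 (ctDir G ψ w₀ R Lo Hi x).2
  rw [← hF] at hAz'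
  push_cast at hAz'
  have hU0 : (0 : ℤ) ≤ (F.UL : ℤ) := by positivity
  have hnz : (0 : ℤ) ≤ (nz : ℤ) * F.UL := by positivity
  nlinarith [hd.1, hLuw.2]

end Zone

end Skelφ

end Summit.CriticalPhenomena.PercolationContinuityZ3.Theorems.Transplant

end
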